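import Literature.IUT.LogThetaLattice.ThetaLinkOfKits
import Literature.IUT.HodgeTheaters.FPrimeStripsRigidity
import Mathlib.CategoryTheory.InducedCategory

/-!
# Non-vacuity of [IUTchIII] Def 1.4: `LogThetaLatticeDiagram.ofKits` / `lgpSkeletonOfKits` over TAGGED toy kits

Mochizuki, *Inter-universal Teichmüller Theory III*, kurims manuscript (May 2020), Def 1.4 pp. 45–46 ("a collection of
distinct `Θ^{±ell}NF`-Hodge theaters … indexed by pairs of integers"), Thm 1.5 (i)(ii) p. 48, Def 3.8 (iii) p. 113;
*I* (May 2020), Def 5.2 pp. 134–135, Cor 5.3 (ii)(iii) p. 144, Def 6.11 (iii) p. 173; *II* (Dec 2020), Cor 4.10 pp. 158–160.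
([IUTchIII] Def 1.4 p.45) [claim: Mochizuki2012, status: disputed]. abc-iut cell, seat abc-iut-w5-d043 (L6 NV register,
row «NV-W2 IUTchIII:Def1.4», lead ruling §F v1.18m (2)). KIT-RULE consistency witness; nothing frozen is touched.

WHY A NEW KIT. `LogThetaLatticeDiagram.ofKits … (H : ℤ × ℤ → FK.ThetaPMEllHT) (hH : Function.Injective H)`
(abc-iut-L6-t3, `ThetaLinkOfKits.lean`) asks for an INJECTIVE `ℤ × ℤ`-family of `Θ^{±ell}`-Hodge-theater structures. Over
abc-iut-L5-t4's toy `ℱ`-kit `FKit.toy` every ambient category is the two-object collage category `Model.Obj l`, so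
`FK.ThetaPMEllHT` has only finitely many provably distinct inhabitants and NO such family exists (abc-iut-w5-d132,
`ThetaLinkOfKitsToy.lean`; this seat's design note) — whence abc-iut-L6-t3's `KitsToy.latticeDiagram` keeps `(H, hH)` as
parameters. Print's own instance of Def 1.4 is "the same Hodge theater regarded as distinct labelled copies"; the honest
kernel rendering of "distinct labelled copies" is TAGGING: here the toy base kit `toyKit l hl` and `MultKit.toy` are kept
VERBATIM and only the Frobenioid-side ambient categories are replaced by `InducedCategory (Model.Obj l) Prod.snd` on
`(ℤ × ℤ) × Model.Obj l` (Mathlib) — every object of `Model.Obj l` duplicated `ℤ × ℤ` times, all copies of an object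
canonically (uniquely, given a morphism downstairs) isomorphic, the forgetful functor `inducedFunctor` fully faithful.

CONTENTS. `FKit.toyTagged` with its `MonoLaws`, [IUTchI] Cor 5.3 (ii) (`toD` fully faithful ⇒ abc-iut-L5-d4's
`isomFtoDBijective_of_fullyFaithful`), Cor 5.3 (iii), Rmk 5.2.1 (ii); the `TimesMuSide`, frame, `LogKit`, `ThetaLinkKit` in
the shapes of `StripFrameOfKitsToy.lean` / `ThetaLinkOfKitsToy.lean`; the family `KitsTaggedToy.thetaPMEllHT p` (`p : ℤ × ℤ`;
codomain `ℱ`-prime-strip := the copy with tag `p` of the model, all other data those of the model theater `Ex62.ht`),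
`thetaPMEllHT_injective`; and the INHABITANTS `KitsTaggedToy.latticeDiagram kind : LogThetaLatticeDiagram _ _`
(= `LogThetaLatticeDiagram.ofKits …`), `KitsTaggedToy.lgpSkeleton kind` (= `lgpSkeletonOfKits …`, abc-iut-L6-t4's Def 3.8 (iii)
skeleton) with Thm 1.5 (i)(ii) holding for them. Consistency ≠ endorsement; no side taken on [IUTchIII] Cor 3.12.
-/

noncomputable section

namespace Literature.IUT.HodgeTheaters.PMBaseKit

open CategoryTheory

variable (l : ℕ) [Fact l.Prime] (hl : l ≠ 2)

/-- **IUTchI:Def5.2(i)** (kurims p.134) The TAGGED toy ambient category: the collage category `Model.Obj l` of abc-iut-L5-t4's toy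
kits with every object duplicated `ℤ × ℤ` times (`InducedCategory` along `Prod.snd`), so that the model `ℱ_v = loc` has the
provably distinct isomorphs `(p, loc)`, `p : ℤ × ℤ`. ([IUTchI] Def 5.2 (i) p.134) [claim: Mochizuki2012, status: disputed] -/
abbrev TaggedObj : Type := InducedCategory (Model.Obj l) (Prod.snd : (ℤ × ℤ) × Model.Obj l → Model.Obj l)

/-- **IUTchI:Def5.2(i)** (kurims p.134) The `ℱ`-PRIME-STRIP KIT OVER THE TOY BASE KIT WITH TAGGED AMBIENT CATEGORIES: `FKit.toy` with
`FAmb v := ThAmb v := TaggedObj l`, models the copy `((0,0), loc)`, `ℱ ↦ 𝒟` / `ℱ ↦ ℱ^⊢` the (fully faithful) forgetful functor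
`inducedFunctor`; the `ℱ^⊢`-, `ℱ^⊩`- and `𝒟^⊢`-sides are those of `FKit.toy` verbatim. ([IUTchI] Def 5.2 (i) p.134)
[claim: Mochizuki2012, status: disputed] -/
def FKit.toyTagged : (toyKit l hl).FKit (MultKit.toy l hl) where
  FAmb _ := TaggedObj l
  fModel _ := (((0 : ℤ), (0 : ℤ)), Model.Obj.loc)
  FmAmb _ := Model.Obj l
  fmModel _ := Model.Obj.loc
  toD _ := inducedFunctor _
  toD_model _ := Iso.refl _
  toFm _ := inducedFunctor _
  toFm_model _ := Iso.refl _
  RlfAmb := ∀ _ : (toyKit l hl).V, Model.Obj l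
  rlfModel := fun _ => Model.Obj.loc
  rlfFm v := Pi.eval _ v
  rlfOf F := fun v => (inducedFunctor _).obj (F v)
  rlfOfMap φ := Pi.isoMk fun v => (inducedFunctor _).mapIso (φ v)
  rlfFm_rlfOf _ _ := Iso.refl _
  ThAmb _ := TaggedObj l
  thModel _ := (((0 : ℤ), (0 : ℤ)), Model.Obj.loc)
  thToF _ := 𝟭 _
  thToF_model _ := Iso.refl _
  toDm _ := SingleObj.star _
  toDmMap _ := 𝟙 _
  toDm_toFm _ _ := ⟨𝟙 _⟩

namespace FKit

/-- **IUTchI:Rmk5.2.1(i)** (kurims p.143) The tagged toy kit satisfies abc-iut-L5-d4's `MonoLaws` (the `𝒟^⊢`-side is the one-object,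
one-morphism category of `MultKit.toy`). ([IUTchI] Rmk 5.2.1 (i) p.143) [claim: Mochizuki2012, status: disputed] -/
def MonoLaws.toyTagged : (FKit.toyTagged l hl).MonoLaws where
  toDmMap_refl _ := rfl
  toDmMap_trans _ _ := rfl
  monoMap_refl _ := rfl
  monoMap_trans _ _ := rfl
  toDmToFm _ := Iso.refl _
  toDmToFm_natural _ := rfl

/-- **IUTchI:Cor5.3(ii)** (kurims p.144) Cor 5.3 (ii) HOLDS over the tagged toy kit: `ℱ_v ↦ 𝒟_v` is the forgetful functor of an induced
category, fully faithful (abc-iut-L5-d4's `isomFtoDBijective_of_fullyFaithful`). ([IUTchI] Cor 5.3 (ii) p.144)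
[claim: Mochizuki2012, status: disputed] -/
theorem isomFtoDBijective_toyTagged : (FKit.toyTagged l hl).IsomFtoDBijective :=
  isomFtoDBijective_of_fullyFaithful fun _ => fullyFaithfulInducedFunctor _

/-- **IUTchI:Cor5.3(iii)** (kurims p.144) Cor 5.3 (iii) HOLDS over the tagged toy kit (its category of `𝒟^⊢`-prime-strips has a single
morphism). ([IUTchI] Cor 5.3 (iii) p.144) [claim: Mochizuki2012, status: disputed] -/
theorem isomFmtoDmSurjective_toyTagged : (FKit.toyTagged l hl).IsomFmtoDmSurjective := by
  intro F₁ F₂ ψ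
  refine ⟨fun v => (F₁.isModel v).some ≪≫ (F₂.isModel v).some.symm, ?_⟩
  rcases ψ with ⟨⟩
  rfl

/-- **IUTchI:Rmk5.2.1(ii)** (kurims p.143) Rmk 5.2.1 (ii) ("`‡𝔉 ↦ ‡𝔉^⊩` forms an `ℱ^⊩`-prime-strip") HOLDS over the tagged toy kit (forget
the tags componentwise). ([IUTchI] Rmk 5.2.1 (ii) p.143) [claim: Mochizuki2012, status: disputed] -/
theorem rlfOfIsStrip_toyTagged : (FKit.toyTagged l hl).RlfOfIsStrip :=
  fun F => ⟨Pi.isoMk fun v => (inducedFunctor _).mapIso (F.isModel v).some⟩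

end FKit

end Literature.IUT.HodgeTheaters.PMBaseKit

namespace Literature.IUT.LogThetaLattice

open CategoryTheory
open Literature.IUT.HodgeTheaters Literature.IUT.HodgeTheaters.PMBaseKit

namespace KitsTaggedToy

variable (l : ℕ) [Fact l.Prime] (hl : l ≠ 2)

/-- **IUTchII:Def4.9(vii)** (kurims p.158) The `TimesMuSide` over the tagged toy kit, in the shape of abc-iut-L6-t3's `KitsToy.timesMuSide`:
`F^{⊢×μ} := F^{⊢▶×μ} :=` the one-object toy `𝒟^⊢`-groupoid, `F^{⊩▶×μ} :=` the `ℱ^⊩`-prime-strips of the tagged kit.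
([IUTchII] Def 4.9 (vii) p.158) [claim: Mochizuki2012, status: disputed] -/
def timesMuSide : TimesMuSide (FKit.toyTagged l hl) (FKit.MonoLaws.toyTagged l hl) where
  Fxm := (MultKit.toy l hl).DMono
  Fvtxm := (MultKit.toy l hl).DMono
  Fglxm := (FKit.toyTagged l hl).FrStrip
  FvToFxm := PrimeStripGroupoids.assocDmFunctor (FKit.MonoLaws.toyTagged l hl)
  FxmToDv := 𝟭 _
  FglToFglxm := 𝟭 _
  FglxmToFvtxm := PrimeStripGroupoids.rlfFmFunctor (FKit.toyTagged l hl)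
      (FKit.nonempty_rlfFm_rlfModel_iso_of_rlfOfIsStrip (FKit.rlfOfIsStrip_toyTagged l hl)) ⋙
    PrimeStripGroupoids.assocDmFunctor (FKit.MonoLaws.toyTagged l hl)
  FvtxmToFxm := 𝟭 _
  fxm_comm := Functor.rightUnitor _
  iso_nonempty_Fxm _ _ := ⟨Iso.refl _⟩
  iso_nonempty_Fglxm := PrimeStripGroupoids.iso_nonempty_FrStrip

/-- **IUTchIII:Def1.1** (kurims p.23) The frame `StripFrame.ofKits` over the tagged toy kit, [IUTchI] Cor 5.3 (ii), (iii) and Rmk 5.2.1 (ii)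
DISCHARGED by the three theorems above. ([IUTchIII] Def 1.1 p.23) [claim: Mochizuki2012, status: disputed] -/
def frame : StripFrame.{1} :=
  StripFrame.ofKits (FKit.MonoLaws.toyTagged l hl) (FKit.isomFtoDBijective_toyTagged l hl)
    (FKit.isomFmtoDmSurjective_toyTagged l hl) (FKit.rlfOfIsStrip_toyTagged l hl) (timesMuSide l hl)

/-- **IUTchIII:Def1.1(i)** (kurims p.24) A log-Frobenius datum over the tagged toy kit: `log := 𝟭` at every place.
([IUTchIII] Def 1.1 (i) p.24) [claim: Mochizuki2012, status: disputed] -/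
def logKit : LogKit (FKit.toyTagged l hl) where
  log _ := 𝟭 _
  log_model _ := ⟨Iso.refl _⟩
  logD v := ((FKit.toyTagged l hl).toD v).leftUnitor

/-- **IUTchIII:Def1.1(iii)** (kurims p.26) The §1 log-strip interface over the tagged toy frame. ([IUTchIII] Def 1.1 (iii) p.26)
[claim: Mochizuki2012, status: disputed] -/
def logStripData : LogStripData (frame l hl) :=
  LogStripData.ofKits _ _ _ _ _ (logKit l hl)

/-- **IUTchI:Def5.2(iv)** (kurims p.135) The MODEL `ℱ^⊩`-prime-strip over the tagged toy kit. ([IUTchI] Def 5.2 (iv) p.135)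
[claim: Mochizuki2012, status: disputed] -/
def frStrip : (FKit.toyTagged l hl).FrStrip := ⟨(FKit.toyTagged l hl).rlfModel, ⟨Iso.refl _⟩⟩

/-- **IUTchII:Cor4.10(iv)** (kurims p.160) In the `F^{⊢×μ}`-prime-strip category of the tagged toy `TimesMuSide` (`SingleObj Unit`) any two
isomorphisms between the same objects coincide. ([IUTchII] Cor 4.10 (iv) p.160) [claim: Mochizuki2012, status: disputed] -/
theorem iso_eq_of_timesMuSide_Fxm {A B : (timesMuSide l hl).Fxm} (e e' : A ≅ B) : e = e' :=
  Iso.ext rfl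

/-- **IUTchII:Cor4.10(i)** (kurims p.158) A `ThetaLinkKit` over the tagged toy kit, in the shape of abc-iut-w5-d132's `KitsToy.thetaLinkKit`:
the three pilot-strip functors CONSTANT at the model `ℱ^⊩`-prime-strip, unit portions the identity, "coincides with the full
poly-isomorphism" (Cor 4.10 (iv)) because the target groupoid has one isomorphism between any two objects.
([IUTchII] Cor 4.10 (i) p.158) [claim: Mochizuki2012, status: disputed] -/
def thetaLinkKit : ThetaLinkKit (timesMuSide l hl) where
  pilotDelta := (Functor.const _).obj (frStrip l hl)
  pilotTheta _ := (Functor.const _).obj (frStrip l hl)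
  unitPortion _ := Iso.refl _
  induced_full k H H' := by
    rw [← Literature.IUT.HodgeArakelov.mapIso_surjective_iff_map_full]
    intro e
    exact ⟨Iso.refl _, iso_eq_of_timesMuSide_Fxm l hl _ _⟩

/-- **IUTchII:Cor4.10(iii)** (kurims p.160) `ThetaLinkData.ofKits` over the tagged toy frame. ([IUTchII] Cor 4.10 (iii) p.160)
[claim: Mochizuki2012, status: disputed] -/
def thetaLinkData : ThetaLinkData (frame l hl) :=
  ThetaLinkData.ofKits (FKit.MonoLaws.toyTagged l hl) (FKit.isomFtoDBijective_toyTagged l hl)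
    (FKit.isomFmtoDmSurjective_toyTagged l hl) (FKit.rlfOfIsStrip_toyTagged l hl) (timesMuSide l hl) (thetaLinkKit l hl)

/-- **IUTchI:Def5.2(i)** (kurims p.134) The copy with tag `p : ℤ × ℤ` of the model `ℱ`-prime-strip over the tagged toy kit.
([IUTchI] Def 5.2 (i) p.134) [claim: Mochizuki2012, status: disputed] -/
def fStrip (p : ℤ × ℤ) : (FKit.toyTagged l hl).FStrip :=
  ⟨fun _ => (p, Model.Obj.loc), fun _ => ⟨InducedCategory.isoMk (Iso.refl _)⟩⟩

/-- **IUTchI:Def6.11(iii)** (kurims p.173) **The family of `Θ^{±ell}`-Hodge theaters `p ↦ ^{p}ℋ𝒯` over the tagged toy kit** (`p : ℤ × ℤ`):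
the model base theater `(𝔇_≻ ⟵ 𝔇_± ⟶ 𝒟^{⊚±})` of [IUTchI] Def 6.4 (iii) (abc-iut-L5-t4's `Ex62.ht`) with capsule the tag-`(0,0)`
copies and codomain `†𝔉_≻ :=` the tag-`p` copy of the model `ℱ`-prime-strip — "the same Hodge theater, regarded as the
copy labelled `p`". ([IUTchI] Def 6.11 (iii) p.173) [claim: Mochizuki2012, status: disputed] -/
def thetaPMEllHT (p : ℤ × ℤ) : (FKit.toyTagged l hl).ThetaPMEllHT where
  T := ZMod l
  grpT := FlPMGroup.tautological l
  capsule _ := fStrip l hl ((0 : ℤ), (0 : ℤ))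
  codomain := fStrip l hl p
  glob := (toyKit l hl).gModel
  dPolyPM := Ex62.poly (toyKit l hl)
  dPolyEll := Ex63.poly (toyKit l hl)
  exists_model := (Ex62.ht (K := toyKit l hl)).exists_model

/-- **IUTchIII:Def1.4** (kurims p.45) The tag is read off the codomain `ℱ`-prime-strip: `(^{p}ℋ𝒯).𝔉_≻ = (p, loc)` at the (unique) place.
([IUTchIII] Def 1.4 p.45) [claim: Mochizuki2012, status: disputed] -/
theorem thetaPMEllHT_codomain_obj (p : ℤ × ℤ) (v : (toyKit l hl).V) :
    (thetaPMEllHT l hl p).codomain.obj v = (p, Model.Obj.loc) := rfl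

/-- **IUTchIII:Def1.4** (kurims p.45) **"Distinct"**: the family `p ↦ ^{p}ℋ𝒯` is INJECTIVE — distinct tags give provably distinct
Hodge-theater structures. ([IUTchIII] Def 1.4 p.45) [claim: Mochizuki2012, status: disputed] -/
theorem thetaPMEllHT_injective : Function.Injective (thetaPMEllHT l hl) := by
  intro p q h
  have h' := congrArg (fun H : (FKit.toyTagged l hl).ThetaPMEllHT => (H.codomain.obj ()).1) h
  simpa [thetaPMEllHT_codomain_obj] using h'

/-- **IUTchIII:Def1.4** (kurims p.45) **[IUTchIII] Def 1.4 INHABITED over kits**: the log-theta-lattice (of either kind) over the tagged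
toy frame — abc-iut-L6-t3's `LogThetaLatticeDiagram.ofKits` applied to the injective family `p ↦ ^{p}ℋ𝒯`; vertical arrows
the full log-links, horizontal arrows the full poly-isomorphisms of [IUTchII] Cor 4.10 (iii). ([IUTchIII] Def 1.4 p.45)
[claim: Mochizuki2012, status: disputed] -/
def latticeDiagram (kind : LatticeKind) : LogThetaLatticeDiagram (logStripData l hl) (thetaLinkData l hl) :=
  LogThetaLatticeDiagram.ofKits (FKit.MonoLaws.toyTagged l hl) (FKit.isomFtoDBijective_toyTagged l hl)
    (FKit.isomFmtoDmSurjective_toyTagged l hl) (FKit.rlfOfIsStrip_toyTagged l hl) (timesMuSide l hl)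
    (thetaLinkKit l hl) (logKit l hl) kind (thetaPMEllHT l hl) (thetaPMEllHT_injective l hl)

/-- **IUTchIII:Def1.4** (kurims p.45) Non-vacuity of the §1 structure `LogThetaLatticeDiagram` over an assembled frame `StripFrame.ofKits`.
([IUTchIII] Def 1.4 p.45) [claim: Mochizuki2012, status: disputed] -/
theorem nonempty_latticeDiagram (kind : LatticeKind) :
    Nonempty (LogThetaLatticeDiagram (logStripData l hl) (thetaLinkData l hl)) :=
  ⟨latticeDiagram l hl kind⟩

/-- **IUTchIII:Def1.4** (kurims p.45) The `(n, m)`-theater of the lattice is the tag-`(n, m)` copy `^{n,m}ℋ𝒯` (as an object of the frame).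
([IUTchIII] Def 1.4 p.45) [claim: Mochizuki2012, status: disputed] -/
theorem latticeDiagram_HT (kind : LatticeKind) (p : ℤ × ℤ) :
    (latticeDiagram l hl kind).HT p = AsSmall.up.obj (HTRep.of (thetaPMEllHT l hl p)) := rfl

/-- **IUTchIII:Def1.4** (kurims p.46) The Gaussian lattice over the tagged toy frame is Gaussian. ([IUTchIII] Def 1.4 p.46)
[claim: Mochizuki2012, status: disputed] -/
theorem latticeDiagram_isGaussian : (latticeDiagram l hl LatticeKind.gaussian).IsGaussian := rfl

/-- **IUTchIII:Thm1.5(i)** (kurims p.48) Thm 1.5 (i) (vertical coricity) holds, NON-VACUOUSLY, for the lattice over the tagged toy frame.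
([IUTchIII] Thm 1.5 (i) p.48) [claim: Mochizuki2012, status: disputed] -/
theorem vertical_inducedDHT_full (kind : LatticeKind) (n m : ℤ) :
    ((latticeDiagram l hl kind).vertical n m).inducedDHT = PolyIso.full _ _ := rfl

/-- **IUTchIII:Thm1.5(ii)** (kurims p.48) Thm 1.5 (ii) (horizontal coricity) holds, NON-VACUOUSLY, for the lattice over the tagged toy
frame (resting on the Cor 4.10 (iv) clause of `thetaLinkKit`). ([IUTchIII] Thm 1.5 (ii) p.48) [claim: Mochizuki2012, status: disputed] -/
theorem horizontal_inducedFxm_full (kind : LatticeKind) (n m : ℤ) :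
    (thetaLinkData l hl).linkInducedFxm kind ((latticeDiagram l hl kind).HT (n, m))
        ((latticeDiagram l hl kind).HT (n + 1, m)) = PolyIso.full _ _ :=
  (latticeDiagram l hl kind).horizontal_inducedFxm_full n m

/-- **IUTchIII:Def3.8(iii)** (kurims p.113) abc-iut-L6-t4's Def 3.8 (iii) lattice SKELETON (the `lat` binder of the Cor 3.12 setting) obtained
from KIT-LEVEL data: `lgpSkeletonOfKits` INHABITED over the tagged toy kit. ([IUTchIII] Def 3.8 (iii) p.113)
[claim: Mochizuki2012, status: disputed] -/
def lgpSkeleton (kind : LatticeKind) :=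
  lgpSkeletonOfKits (FKit.MonoLaws.toyTagged l hl) (FKit.isomFtoDBijective_toyTagged l hl)
    (FKit.isomFmtoDmSurjective_toyTagged l hl) (FKit.rlfOfIsStrip_toyTagged l hl) (timesMuSide l hl)
    (thetaLinkKit l hl) (logKit l hl) kind (thetaPMEllHT l hl) (thetaPMEllHT_injective l hl)

/-- **IUTchIII:Def3.8(iii)** (kurims p.113) The skeleton's `(n, m)`-theater is `^{n,m}ℋ𝒯`. ([IUTchIII] Def 3.8 (iii) p.113)
[claim: Mochizuki2012, status: disputed] -/
theorem lgpSkeleton_theater (kind : LatticeKind) (n m : ℤ) :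
    (lgpSkeleton l hl kind).theater n m = AsSmall.up.obj (HTRep.of (thetaPMEllHT l hl (n, m))) := rfl

/-- **IUTchIII:Def3.8(iii)** (kurims p.113) The skeleton's theaters are pairwise distinct. ([IUTchIII] Def 3.8 (iii) p.113)
[claim: Mochizuki2012, status: disputed] -/
theorem lgpSkeleton_theater_injective (kind : LatticeKind) :
    Function.Injective fun p : ℤ × ℤ => (lgpSkeleton l hl kind).theater p.1 p.2 := fun _ _ h =>
  (latticeDiagram l hl kind).injective h

end KitsTaggedToy

end Literature.IUT.LogThetaLattice

end
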